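import Literature.AlgebraicGeometry.Resolution.WeightedCentreTheoremFPrime
import HarnessLib

/-!
# Weighted centres — (P) is a condition on the weight CLASS: `SlotPinned w l g → SlotPinned w z g` for `w z = w l`

Instrument for engine 1's `W(f)` TOY MODEL (cell `pub-rosobs`; glue between the engine's class-level hypothesis "(P) at `L₁`" of LF-MODEL-eng1-g45 §6.2 and the slot-level
hypothesis `Truncation.SlotPinned w z g` at the MOVED slot used by `WeightedCentreTheoremAPlus` / `WeightedCentreBottomOne`), NOT a resolution theorem and NOT about the
invariant of [AbramovichTemkinWlodarczyk2024].

The transposition of two slots of equal weight is a graded automorphism pair, and killing the light variables commutes with it; hence `X_l` pinned in `Φ g` for every graded pair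
forces `X_z` pinned in `Φ g` for every graded pair (`SlotPinned.of_weight_eq`).  Bookkeeping: `killLight_rename`, `isGradedAutPair_rename`.

References: [AbramovichTemkinWlodarczyk2024, §5.1 (p. 1575)]; [Lang2002, Ch. XIII §4].
-/

namespace Literature.AlgebraicGeometry.Resolution.WeightedBlowup

open MvPolynomial Truncation

section Rename

variable {L : Type*} [CommRing L] {ι : Type*}

/-- **Killing the light variables commutes with an `H`-preserving renaming** (bookkeeping). [cite: AbramovichTemkinWlodarczyk2024, §5.1 (p. 1575)] -/
theorem killLight_rename (H : ι → Prop) [DecidablePred H] (σ : ι → ι) (hσ : ∀ j, H (σ j) ↔ H j) (F : MvPolynomial ι L) :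
    killLight H (rename σ F) = rename σ (killLight H F) := by
  induction F using MvPolynomial.induction_on with
  | C a => simp only [MvPolynomial.algHom_C, AlgHom.commutes]
  | add P Q hP hQ => simp only [map_add, hP, hQ]
  | mul_X P i hP =>
    rw [map_mul, rename_X, map_mul, killLight_X, hP, map_mul, killLight_X, map_mul]
    congr 1
    rw [heavyX, heavyX]
    by_cases h : H i
    · rw [if_pos ((hσ i).mpr h), if_pos h, rename_X]
    · rw [if_neg (mt (hσ i).mp h), if_neg h, map_zero]

end Rename

section Class

variable {L : Type*} [Field L] {ι : Type*} [DecidableEq ι] (w : ι → ℚ)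

omit [DecidableEq ι] in
/-- **Renaming along a weight-preserving permutation is a graded automorphism pair** (bookkeeping). [cite: AbramovichTemkinWlodarczyk2024, §5.1 (p. 1575)] -/
theorem Truncation.isGradedAutPair_rename (e : ι ≃ ι) (he : ∀ j, w (e j) = w j) :
    IsGradedAutPair w (rename e : MvPolynomial ι L →ₐ[L] MvPolynomial ι L) (rename e.symm : MvPolynomial ι L →ₐ[L] MvPolynomial ι L) := by
  refine ⟨fun i => ?_, fun i => ?_, fun g => ?_, fun g => ?_⟩
  · rw [rename_X, ← he i]
    exact isWeightedHomogeneous_X L w (e i)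
  · have h := he (e.symm i)
    rw [Equiv.apply_symm_apply] at h
    rw [rename_X, h]
    exact isWeightedHomogeneous_X L w (e.symm i)
  · rw [rename_rename, Equiv.self_comp_symm, rename_id, AlgHom.id_apply]
  · rw [rename_rename, Equiv.symm_comp_self, rename_id, AlgHom.id_apply]

/-- **(P) is a condition on the weight class**: `SlotPinned w l g` and `w z = w l` imply `SlotPinned w z g` (test the given graded pair composed with the transposition `(l z)`,
which is graded as `w z = w l`; killing the light variables commutes with it).  Instrument for engine 1's `W(f)` toy model, NOT a resolution theorem.
[cite: AbramovichTemkinWlodarczyk2024, §5.1 (p. 1575); Lang2002, Ch. XIII §4] -/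
theorem Truncation.SlotPinned.of_weight_eq {l z : ι} {g : MvPolynomial ι L} (hl : SlotPinned w l g) (hzl : w z = w l) : SlotPinned w z g := by
  intro Φ Φ' hpair
  have he : ∀ j, w (Equiv.swap l z j) = w j := fun j => by
    rcases eq_or_ne j l with rfl | hjl
    · rw [Equiv.swap_apply_left, hzl]
    rcases eq_or_ne j z with rfl | hjz
    · rw [Equiv.swap_apply_right, hzl]
    rw [Equiv.swap_apply_of_ne_of_ne hjl hjz]
  have h := hl _ _ ((isGradedAutPair_rename w (Equiv.swap l z) he).comp w hpair)
  rw [IsPinnedIn, AlgHom.comp_apply, killLight_rename _ (Equiv.swap l z) (fun j => by rw [he j]) (Φ g)] at h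
  obtain ⟨j, hj, hje⟩ := Finset.mem_image.mp (vars_rename _ _ h)
  have hjz : j = z := (Equiv.swap l z).injective (by rw [hje, Equiv.swap_apply_right])
  rw [IsPinnedIn, hzl]
  rwa [hjz] at hj

end Class

end Literature.AlgebraicGeometry.Resolution.WeightedBlowup
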